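import Summits.QuantumFields.GaugeBoot.DiagonalRPTorusCharacterMoments
import Literature.MathematicalPhysics.QuantumFieldTheory.UnitaryTraceConcentration
import HarnessLib

/-!
# Quadratic Haar moments for `G ≅ U(N)` (gauge-boot, task L3(π), supplement 1/2)

HONEST FRAMING (cell `pub-gaugeboot`, page 1 of every file): the venture produces certified bounds
on lattice expectations at stated coupling, gauge group, dimension and torus size; NOT a mass gap,
NOT a continuum limit, NOT a string tension; NOT Yang–Mills-summit-bearing (barriers
`FixedCouplingUltralocality`, `PerturbativeInvisibility`). This module is compact-group
integration feeding the structural NEGATIVE results `DiagonalRPTorusNegativeOddSUN` /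
`DiagonalRPTorusInnerHalfNegativeEvenSUN` for the unitary groups `U(N)` (`U(1)` = compact QED
included); it discharges nothing else.

## Content (`G ≅ U(N)` through `IsUnitaryModel ρ`, `N ≥ 1`)

* `neg_one_mem_unitaryGroup`, `exists_smul_one_unitary` — the centre element `ρ z = (-1) • 1`;
* invariance of Haar integrals through the model (`integral_comp_mul_left_unitary`,
  `integral_comp_mul_right_unitary`), `map_inv_eq_star_unitary`;
* `integral_entry_mul_conj_entry_unitary` — **`∫ ρ(g)_{ai} conj ρ(g)_{bk} dg = δ_{ab} δ_{ik}/N`**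
  (sign twists `diag(-1 at a)` on the left / right, column symmetry by signed transpositions,
  unitarity row sum);
* `integral_entry_mul_entry_eq_zero_unitary` — **`∫ ρ(g)_{ab} ρ(g)_{ij} dg = 0`** for every `N ≥ 1`
  (twist by `diag(i at a)` or `diag(-1 at a)`).

Folklore (Schur orthogonality for the defining representation of `U(N)`; e.g. M. Creutz, *Quarks,
gluons and lattices* (1983) §8); everything is proved, no definition, no named fact.
-/

noncomputable section

open MeasureTheory Complex Finset
open Literature.MathematicalPhysics.QuantumFieldTheory
open Summit.Ventures.YMGap.RobustBall.HaarSecondMoments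

namespace Summit.QuantumFields.GaugeBoot

namespace DiagRPSUN

/-! ## Unitary matrices used for the twists -/

section Matrices

variable {N : ℕ}

/-- A diagonal matrix with unit-modulus entries is unitary. -/
theorem diagonal_mem_unitaryGroup {d : Fin N → ℂ} (hd : ∀ i, d i * (starRingEnd ℂ) (d i) = 1) :
    Matrix.diagonal d ∈ Matrix.unitaryGroup (Fin N) ℂ := by
  rw [Matrix.mem_unitaryGroup_iff, Matrix.star_eq_conjTranspose, Matrix.diagonal_conjTranspose,
    Matrix.diagonal_mul_diagonal, ← Matrix.diagonal_one]
  congr 1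
  funext j
  simpa [Pi.star_apply] using hd j

/-- The sign twist `diag(…, -1 (at a), …)` is unitary. -/
theorem diagonal_neg_mem (a : Fin N) :
    Matrix.diagonal (Pi.mulSingle a (-1 : ℂ)) ∈ Matrix.unitaryGroup (Fin N) ℂ := by
  refine diagonal_mem_unitaryGroup fun j => ?_
  rcases eq_or_ne j a with rfl | hja
  · simp
  · simp [Pi.mulSingle_eq_of_ne hja]

/-- The phase twist `diag(…, i (at a), …)` is unitary. -/
theorem diagonal_I_mem (a : Fin N) :
    Matrix.diagonal (Pi.mulSingle a Complex.I) ∈ Matrix.unitaryGroup (Fin N) ℂ := by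
  refine diagonal_mem_unitaryGroup fun j => ?_
  rcases eq_or_ne j a with rfl | hja
  · simp [Complex.conj_I]
  · simp [Pi.mulSingle_eq_of_ne hja]

/-- A special unitary matrix is unitary (for the signed transpositions). -/
theorem mem_unitaryGroup_of_mem_specialUnitaryGroup {S : Matrix (Fin N) (Fin N) ℂ}
    (h : S ∈ Matrix.specialUnitaryGroup (Fin N) ℂ) : S ∈ Matrix.unitaryGroup (Fin N) ℂ :=
  ((Matrix.mem_specialUnitaryGroup_iff).1 h).1

/-- `-1 ∈ U(N)`. -/
theorem neg_one_mem_unitaryGroup : (-1 : Matrix (Fin N) (Fin N) ℂ) ∈ Matrix.unitaryGroup (Fin N) ℂ := by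
  rw [Matrix.mem_unitaryGroup_iff, star_neg, star_one, neg_mul_neg, one_mul]

end Matrices

/-! ## Haar invariance through the model `ρ : G ≅ U(N)` -/

section Moments

variable {N : ℕ} {G : Type*} [Group G] [TopologicalSpace G] [IsTopologicalGroup G] [CompactSpace G]
  [MeasurableSpace G] [BorelSpace G] (ρ : G →* Matrix (Fin N) (Fin N) ℂ)

omit [IsTopologicalGroup G] [CompactSpace G] [MeasurableSpace G] [BorelSpace G] in
/-- **A non-trivial centre element**: for `G ≅ U(N)`, some `z : G` has `ρ z = (-1) • 1`. -/
theorem exists_smul_one_unitary (hρ : IsUnitaryModel ρ) :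
    ∃ z : G, ∃ ω : ℂ, ω ≠ 1 ∧ ρ z = ω • (1 : Matrix (Fin N) (Fin N) ℂ) := by
  obtain ⟨z, hz⟩ := IsUnitaryModel.exists_eq ρ hρ (neg_one_mem_unitaryGroup (N := N))
  refine ⟨z, -1, by norm_num, ?_⟩
  rw [hz, neg_smul, one_smul]

omit [IsTopologicalGroup G] [CompactSpace G] [MeasurableSpace G] [BorelSpace G] in
/-- `ρ(g⁻¹) = ρ(g)^*` for a unitary model. -/
theorem map_inv_eq_star_unitary (hρ : IsUnitaryModel ρ) (g : G) : ρ g⁻¹ = star (ρ g) := by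
  have hu := IsUnitaryModel.mem_unitaryGroup ρ hρ g
  rw [Matrix.mem_unitaryGroup_iff] at hu
  have h1 : ρ g⁻¹ * ρ g = 1 := by rw [← map_mul, inv_mul_cancel, map_one]
  calc ρ g⁻¹ = ρ g⁻¹ * (ρ g * star (ρ g)) := by rw [hu, mul_one]
    _ = star (ρ g) := by rw [← mul_assoc, h1, one_mul]

/-- **Left invariance through the model**: `∫ F(S ρ(g)) dg = ∫ F(ρ(g)) dg` for every `S ∈ U(N)`. -/
theorem integral_comp_mul_left_unitary (hρ : IsUnitaryModel ρ) {S : Matrix (Fin N) (Fin N) ℂ}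
    (hS : S ∈ Matrix.unitaryGroup (Fin N) ℂ) {E : Type*} [NormedAddCommGroup E] [NormedSpace ℝ E]
    (F : Matrix (Fin N) (Fin N) ℂ → E) :
    ∫ g, F (S * ρ g) ∂haarProbability G = ∫ g, F (ρ g) ∂haarProbability G := by
  obtain ⟨z, hz⟩ := IsUnitaryModel.exists_eq ρ hρ hS
  simpa only [map_mul, hz] using integral_mul_left_eq_self (μ := haarProbability G) (fun g => F (ρ g)) z

/-- **Right invariance through the model**: `∫ F(ρ(g) S) dg = ∫ F(ρ(g)) dg` for every `S ∈ U(N)`. -/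
theorem integral_comp_mul_right_unitary (hρ : IsUnitaryModel ρ) {S : Matrix (Fin N) (Fin N) ℂ}
    (hS : S ∈ Matrix.unitaryGroup (Fin N) ℂ) {E : Type*} [NormedAddCommGroup E] [NormedSpace ℝ E]
    (F : Matrix (Fin N) (Fin N) ℂ → E) :
    ∫ g, F (ρ g * S) ∂haarProbability G = ∫ g, F (ρ g) ∂haarProbability G := by
  obtain ⟨z, hz⟩ := IsUnitaryModel.exists_eq ρ hρ hS
  simpa only [map_mul, hz] using integral_mul_right_eq_self (μ := haarProbability G) (fun g => F (ρ g)) z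

/-! ## The quadratic moments of the entries -/

/-- Different rows are orthogonal in mean (left sign twist at the row `a`). -/
theorem integral_entry_mul_conj_entry_eq_zero_of_row_ne_unitary (hρ : IsUnitaryModel ρ) {a b : Fin N}
    (hab : a ≠ b) (i k : Fin N) :
    ∫ g, ρ g a i * (starRingEnd ℂ) (ρ g b k) ∂haarProbability G = 0 := by
  set D := Matrix.diagonal (Pi.mulSingle a (-1 : ℂ)) with hD
  have h := integral_comp_mul_left_unitary ρ hρ (diagonal_neg_mem a) (fun M => M a i * (starRingEnd ℂ) (M b k))
  have hDa : ∀ M : Matrix (Fin N) (Fin N) ℂ, (D * M) a i = -M a i := fun M => by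
    rw [hD, Matrix.diagonal_mul]; simp
  have hDb : ∀ M : Matrix (Fin N) (Fin N) ℂ, (D * M) b k = M b k := fun M => by
    rw [hD, Matrix.diagonal_mul]; simp [Pi.mulSingle_eq_of_ne hab.symm]
  have hpt : ∀ M : Matrix (Fin N) (Fin N) ℂ,
      (D * M) a i * (starRingEnd ℂ) ((D * M) b k) = -(M a i * (starRingEnd ℂ) (M b k)) := fun M => by
    rw [hDa, hDb, neg_mul]
  simp only [← hD, hpt] at h
  exact integral_eq_zero_of_neg h

/-- Different columns are orthogonal in mean (right sign twist at the column `i`). -/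
theorem integral_entry_mul_conj_entry_eq_zero_of_col_ne_unitary (hρ : IsUnitaryModel ρ) (a b : Fin N)
    {i k : Fin N} (hik : i ≠ k) :
    ∫ g, ρ g a i * (starRingEnd ℂ) (ρ g b k) ∂haarProbability G = 0 := by
  set D := Matrix.diagonal (Pi.mulSingle i (-1 : ℂ)) with hD
  have h := integral_comp_mul_right_unitary ρ hρ (diagonal_neg_mem i) (fun M => M a i * (starRingEnd ℂ) (M b k))
  have hDi : ∀ M : Matrix (Fin N) (Fin N) ℂ, (M * D) a i = -M a i := fun M => by
    rw [hD, Matrix.mul_diagonal]; simp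
  have hDk : ∀ M : Matrix (Fin N) (Fin N) ℂ, (M * D) b k = M b k := fun M => by
    rw [hD, Matrix.mul_diagonal]; simp [Pi.mulSingle_eq_of_ne hik.symm]
  have hpt : ∀ M : Matrix (Fin N) (Fin N) ℂ,
      (M * D) a i * (starRingEnd ℂ) ((M * D) b k) = -(M a i * (starRingEnd ℂ) (M b k)) := fun M => by
    rw [hDi, hDk, neg_mul]
  simp only [← hD, hpt] at h
  exact integral_eq_zero_of_neg h

/-- The mean square modulus of an entry does not depend on the column (right twist by a signed
transposition). -/
theorem integral_normSq_entry_eq_of_col_unitary (hρ : IsUnitaryModel ρ) (a i j : Fin N) :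
    ∫ g, ρ g a i * (starRingEnd ℂ) (ρ g a i) ∂haarProbability G =
      ∫ g, ρ g a j * (starRingEnd ℂ) (ρ g a j) ∂haarProbability G := by
  rcases eq_or_ne i j with rfl | hij
  · rfl
  set T := Matrix.swap ℂ i j * Matrix.diagonal (Pi.mulSingle i (-1 : ℂ)) with hT
  have hTm : T ∈ Matrix.unitaryGroup (Fin N) ℂ := by
    rw [hT]; exact mem_unitaryGroup_of_mem_specialUnitaryGroup (swap_mul_sign_mem i j hij)
  have h := integral_comp_mul_right_unitary ρ hρ hTm (fun M => M a i * (starRingEnd ℂ) (M a i))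
  have hTa : ∀ M : Matrix (Fin N) (Fin N) ℂ, (M * T) a i = -M a j := fun M => by
    rw [hT, ← Matrix.mul_assoc, Matrix.mul_diagonal, Matrix.mul_swap_apply_left]; simp
  have hpt : ∀ M : Matrix (Fin N) (Fin N) ℂ,
      (M * T) a i * (starRingEnd ℂ) ((M * T) a i) = M a j * (starRingEnd ℂ) (M a j) := fun M => by
    rw [hTa, map_neg, neg_mul_neg]
  simp only [hpt] at h
  exact h.symm

/-- Unitarity row sum in mean: `Σ_i ∫ |ρ(g)_{ai}|² dg = 1`. -/
theorem sum_integral_normSq_entry_unitary (hρ : IsUnitaryModel ρ) (a : Fin N) :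
    ∑ i, ∫ g, ρ g a i * (starRingEnd ℂ) (ρ g a i) ∂haarProbability G = 1 := by
  rw [← integral_finsetSum _ (fun i _ => integrable_entry_mul_conj_entry ρ hρ.1 a i a i)]
  have hrow : ∀ g : G, ∑ i, ρ g a i * (starRingEnd ℂ) (ρ g a i) = 1 := by
    intro g
    have hu := IsUnitaryModel.mem_unitaryGroup ρ hρ g
    rw [Matrix.mem_unitaryGroup_iff] at hu
    have h := congrFun (congrFun hu a) a
    rw [Matrix.mul_apply, Matrix.one_apply_eq] at h
    simpa [Matrix.star_apply, Complex.star_def] using h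
  simp_rw [hrow]
  simp

/-- `∫ |ρ(g)_{ai}|² dg = 1/N` for every entry. -/
theorem integral_normSq_entry_unitary (hρ : IsUnitaryModel ρ) (a i : Fin N) :
    ∫ g, ρ g a i * (starRingEnd ℂ) (ρ g a i) ∂haarProbability G = (N : ℂ)⁻¹ := by
  have h1 := sum_integral_normSq_entry_unitary ρ hρ a
  have h2 : ∑ j : Fin N, ∫ g, ρ g a j * (starRingEnd ℂ) (ρ g a j) ∂haarProbability G =
      ∑ _j : Fin N, ∫ g, ρ g a i * (starRingEnd ℂ) (ρ g a i) ∂haarProbability G :=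
    Finset.sum_congr rfl fun j _ => (integral_normSq_entry_eq_of_col_unitary ρ hρ a i j).symm
  rw [h2, Finset.sum_const, Finset.card_univ, Fintype.card_fin, nsmul_eq_mul] at h1
  exact eq_inv_of_mul_eq_one_right h1

/-- ★ **The quadratic Haar moments of `U(N)`**: `∫ ρ(g)_{ai} conj(ρ(g)_{bk}) dg = δ_{ab} δ_{ik}/N`
for a compact group `G ≅ U(N)`. -/
theorem integral_entry_mul_conj_entry_unitary (hρ : IsUnitaryModel ρ) (a i b k : Fin N) :
    ∫ g, ρ g a i * (starRingEnd ℂ) (ρ g b k) ∂haarProbability G =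
      if a = b ∧ i = k then (N : ℂ)⁻¹ else 0 := by
  split_ifs with h
  · obtain ⟨rfl, rfl⟩ := h
    exact integral_normSq_entry_unitary ρ hρ a i
  · rcases ne_or_eq a b with hab | rfl
    · exact integral_entry_mul_conj_entry_eq_zero_of_row_ne_unitary ρ hρ hab i k
    · have hik : i ≠ k := fun hik => h ⟨rfl, hik⟩
      exact integral_entry_mul_conj_entry_eq_zero_of_col_ne_unitary ρ hρ a a hik

/-- ★ **`∫ ρ(g)_{ab} ρ(g)_{ij} dg = 0` for `G ≅ U(N)`, every `N`** (left twist by `diag(i at a)`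
if `a = i`, by `diag(-1 at a)` if `a ≠ i`). -/
theorem integral_entry_mul_entry_eq_zero_unitary (hρ : IsUnitaryModel ρ) (a b i j : Fin N) :
    ∫ g, ρ g a b * ρ g i j ∂haarProbability G = 0 := by
  rcases eq_or_ne i a with rfl | hia
  · set D := Matrix.diagonal (Pi.mulSingle i Complex.I) with hD
    have h := integral_comp_mul_left_unitary ρ hρ (diagonal_I_mem i) (fun M => M i b * M i j)
    have hDa : ∀ (M : Matrix (Fin N) (Fin N) ℂ) (c : Fin N), (D * M) i c = Complex.I * M i c :=
      fun M c => by rw [hD, Matrix.diagonal_mul]; simp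
    have hpt : ∀ M : Matrix (Fin N) (Fin N) ℂ, (D * M) i b * (D * M) i j = -(M i b * M i j) := fun M => by
      rw [hDa, hDa]
      linear_combination (M i b * M i j) * Complex.I_mul_I
    simp only [← hD, hpt] at h
    exact integral_eq_zero_of_neg h
  · set D := Matrix.diagonal (Pi.mulSingle a (-1 : ℂ)) with hD
    have h := integral_comp_mul_left_unitary ρ hρ (diagonal_neg_mem a) (fun M => M a b * M i j)
    have hDa : ∀ M : Matrix (Fin N) (Fin N) ℂ, (D * M) a b = -M a b := fun M => by
      rw [hD, Matrix.diagonal_mul]; simp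
    have hDi : ∀ M : Matrix (Fin N) (Fin N) ℂ, (D * M) i j = M i j := fun M => by
      rw [hD, Matrix.diagonal_mul]; simp [Pi.mulSingle_eq_of_ne hia]
    have hpt : ∀ M : Matrix (Fin N) (Fin N) ℂ, (D * M) a b * (D * M) i j = -(M a b * M i j) := fun M => by
      rw [hDa, hDi, neg_mul]
    simp only [← hD, hpt] at h
    exact integral_eq_zero_of_neg h

end Moments

end DiagRPSUN

end Summit.QuantumFields.GaugeBoot
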